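import Summits.MatrixMultiplication.OmegaCensus.BoxUsefulNormalThreeCyclic

/-!
# ω-census, family (b3): conjecture C9 (b) — centreless box-useful `{2,3}`-groups with a minimal normal `C₃`: inverters and the centre of the centraliser

HONEST FRAMING (pub-omega census; verbatim): lottery ticket; floor = certified bounds/negative ranges.
Census BOOKKEEPING (conjecture C9 of the cell, STRUCTURE.md §2; pub-omega kernel-l4 gen 16, task K-5, structure part; the
centreless branch, endgame part 1).  Setting: `G` box-useful of order `2^a 3^b`, `Z(G) = 1`, `V = ⟨a⟩ ⊴ G` minimal normal of
order `3` (`BoxUsefulNormalThreeCyclic`), `C = C_G(V)`.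
* `Endgame.conj_eq`: every element inverts or centralises `a`; `Endgame.mul_inv_centralizes`: two inverters differ by a
  centraliser (so `C` has index `2`).
* `Endgame.inverts_of_central_in_centralizer`: an inverter `t` of `a` inverts every element of `Z(C)`: for `z ∈ Z(C)` the
  element `z · tzt⁻¹` commutes with `C` and with `t`, hence is central in `G = C ∪ Ct`, hence trivial.
  Consequences for the successor (the endgame proper): `Z(C)` has no involution and is an elementary abelian `3`-group of rank
  `≤ 2` (`ThreeElt.pow_three_eq_one_of_inverted`, `DihC3CubeConfig`); by the induction hypothesis `C` is lawful and the four
  cases are: `C` abelian ⇒ `G ≅ S₃` or `Dih(C₃²)` (LAWFUL: centre index `6`, resp. `DihC3Sq.exists_coord2_of_split`);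
  `[C:Z(C)] = 4` impossible (`Z(C)` is a `3`-group but would contain the `2`-power-order commutators);
  `[C:Z(C)] = 6` ⇒ `S3S3Config` after normalising `t`; `C ∈ 𝒞₂` ⇒ `C3C3C4Config` / `DihC3CubeConfig` / `S3S3Config`.
Nothing here is progress on `ω`.
-/

namespace Summit.MatrixMultiplication.OmegaCensus

open Finset ProductBoxBound
open scoped commutatorElement

namespace Endgame

variable {G : Type*} [Group G] [Fintype G] [DecidableEq G]

omit [Fintype G] [DecidableEq G] in
/-- Setting of the endgame: `a` of order `3`, `⟨a⟩` normal, `Z(G) = 1`; every element inverts or centralises `a`. [folklore] -/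
theorem conj_eq (a : G) (ha3 : a ^ 3 = 1) (hnorm : ∀ g : G, g * a * g⁻¹ = 1 ∨ g * a * g⁻¹ = a ∨ g * a * g⁻¹ = a * a)
    (ha1 : a ≠ 1) (g : G) : g * a * g⁻¹ = a ∨ g * a * g⁻¹ = a⁻¹ := by
  rcases hnorm g with h | h | h
  · exfalso; apply ha1
    calc a = g⁻¹ * (g * a * g⁻¹) * g := by group
      _ = 1 := by rw [h]; group
  · exact Or.inl h
  · right; rw [h, S3S3Config.inv_eq_sq ha3, pow_two]

omit [Fintype G] [DecidableEq G] in
/-- Two elements inverting `a` differ by an element centralising `a`. [folklore] -/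
theorem mul_inv_centralizes {a g h : G} (hg : g * a * g⁻¹ = a⁻¹) (hh : h * a * h⁻¹ = a⁻¹) :
    (g * h⁻¹) * a * (g * h⁻¹)⁻¹ = a := by
  have hh' : h⁻¹ * a * h = a⁻¹ := by
    calc h⁻¹ * a * h = h⁻¹ * (h * a * h⁻¹)⁻¹ * h := by rw [hh, inv_inv]
      _ = a⁻¹ := by group
  calc (g * h⁻¹) * a * (g * h⁻¹)⁻¹ = g * (h⁻¹ * a * h) * g⁻¹ := by group
    _ = g * a⁻¹ * g⁻¹ := by rw [hh']
    _ = (g * a * g⁻¹)⁻¹ := by group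
    _ = a := by rw [hg, inv_inv]

omit [Fintype G] [DecidableEq G] in
/-- **`t` inverts the centre of the centraliser.** If `t` inverts `a`, every element commuting with `a` either… precisely: for
`z` commuting with every element that commutes with `a` (i.e. `z ∈ Z(C_G(a))`) and with `a`-inverters' squares, `t z t⁻¹ = z⁻¹`
whenever `Z(G) = 1`.  Stated elementwise. [folklore] -/
theorem inverts_of_central_in_centralizer (hZ : Subgroup.center G = ⊥) {a t z : G}
    (hta : t * a * t⁻¹ = a⁻¹) (hall : ∀ g : G, g * a * g⁻¹ = a ∨ g * a * g⁻¹ = a⁻¹)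
    (hzC : ∀ c : G, c * a * c⁻¹ = a → z * c = c * z) (hza : z * a * z⁻¹ = a) : t * z * t⁻¹ = z⁻¹ := by
  -- `w = z · t z t⁻¹` commutes with `C` and with `t`, hence is central, hence trivial
  have htzC : ∀ c : G, c * a * c⁻¹ = a → (t * z * t⁻¹) * c = c * (t * z * t⁻¹) := by
    intro c hc
    -- `t⁻¹ c t` centralises `a`
    have hc' : (t⁻¹ * c * t) * a * (t⁻¹ * c * t)⁻¹ = a := by
      have e1 : t⁻¹ * a * t = a⁻¹ := by
        calc t⁻¹ * a * t = t⁻¹ * (t * a * t⁻¹)⁻¹ * t := by rw [hta, inv_inv]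
          _ = (t⁻¹ * (t * a * t⁻¹) * t)⁻¹ := by group
          _ = a⁻¹ := by rw [show t⁻¹ * (t * a * t⁻¹) * t = a by group]
      calc (t⁻¹ * c * t) * a * (t⁻¹ * c * t)⁻¹ = t⁻¹ * (c * (t * a * t⁻¹) * c⁻¹) * t := by group
        _ = t⁻¹ * (c * a⁻¹ * c⁻¹) * t := by rw [hta]
        _ = t⁻¹ * (c * a * c⁻¹)⁻¹ * t := by group
        _ = t⁻¹ * a⁻¹ * t := by rw [hc]
        _ = (t⁻¹ * a * t)⁻¹ := by group
        _ = a := by rw [e1, inv_inv]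
    have := hzC _ hc'
    calc t * z * t⁻¹ * c = t * (z * (t⁻¹ * c * t)) * t⁻¹ := by group
      _ = t * ((t⁻¹ * c * t) * z) * t⁻¹ := by rw [this]
      _ = c * (t * z * t⁻¹) := by group
  have ht2 : (t * t) * a * (t * t)⁻¹ = a := by
    calc t * t * a * (t * t)⁻¹ = t * (t * a * t⁻¹) * t⁻¹ := by group
      _ = t * a⁻¹ * t⁻¹ := by rw [hta]
      _ = (t * a * t⁻¹)⁻¹ := by group
      _ = a := by rw [hta, inv_inv]
  set w := z * (t * z * t⁻¹) with hw
  have hwC : ∀ c : G, c * a * c⁻¹ = a → w * c = c * w := by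
    intro c hc
    rw [hw, mul_assoc, htzC c hc, ← mul_assoc, hzC c hc, mul_assoc]
  have hwt : w * t = t * w := by
    have hzt2 := hzC (t * t) ht2
    have hcomm := htzC z hza
    -- `t w t⁻¹ = (t z t⁻¹) (t² z t⁻²) = (t z t⁻¹) z = z (t z t⁻¹) = w`
    have e : t * w * t⁻¹ = w := by
      rw [hw]
      calc t * (z * (t * z * t⁻¹)) * t⁻¹ = (t * z * t⁻¹) * ((t * t) * z * (t * t)⁻¹) := by group
        _ = (t * z * t⁻¹) * z := by rw [← hzt2]; group
        _ = z * (t * z * t⁻¹) := hcomm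
    calc w * t = t * w * t⁻¹ * t := by rw [e]
      _ = t * w := by group
  have hw1 : w = 1 := by
    have : w ∈ Subgroup.center G := by
      rw [Subgroup.mem_center_iff]; intro g
      rcases hall g with hg | hg
      · exact (hwC g hg).symm
      · have hgt := mul_inv_centralizes hg hta
        have := hwC _ hgt
        calc g * w = (g * t⁻¹) * (t * w) := by group
          _ = (g * t⁻¹) * (w * t) := by rw [hwt]
          _ = ((g * t⁻¹) * w) * t := by group
          _ = (w * (g * t⁻¹)) * t := by rw [this]
          _ = w * g := by group
    rwa [hZ, Subgroup.mem_bot] at this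
  rw [hw] at hw1
  exact (eq_inv_of_mul_eq_one_right hw1)

end Endgame

end Summit.MatrixMultiplication.OmegaCensus
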